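import Summits.HubbardSuperconductivity.HubbardSuperconductivity.Theses.CooperSharpness

/-!
# Birth skeleton (BC3) of the crux `LocalConvexStep` (stmt-HubbardSuperconductivity-19058; piece V of the
crux-strategist split of `CooperCoordinateGrowth`, stmt-HubbardSuperconductivity-12848)

BCS CONVEXITY = PAIR COMPRESSIBILITY × CONDENSATE DOMINANCE.  Two registered stubs and the kernel-checked composition
`LocalConvexStep_of : stub_pairCompressibility → stub_condensateDominance → LocalConvexStep`.

Write `ρ_L(ψ) = L⁻² Re⟨ψ, K_L ψ⟩`, `K_L = Σ_x P_xᴴ P_x` (the local `d`-pair density — the operator the coupling `g`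
multiplies; `dE₀/dg = −⟨K_L⟩` by Feynman–Hellmann, so `ρ_L` is WEAKLY monotone in `g` for any two ground states by
the two-sided variational inequality `(g₃ − g₂)(⟨K⟩₃ − ⟨K⟩₂) ≥ 0`).
* `stub_pairCompressibility` — STRICT monotonicity at a rate: over steps of length `≤ s` in `[−γ, 0]` in the
  incipiently ordered regime, `∀ψ₃ ∃ψ₂  ρ(ψ₂) + c₁ (g₃ − g₂) ≤ ρ(ψ₃) + η_L` (pair compressibility `−L⁻²d²E₀/dg²`
  bounded below; BCS/RPA: it is `O(1)` per site at weak coupling).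
* `stub_condensateDominance` (hardest) — in the incipiently ordered regime a fixed fraction of the added local pair
  density is carried by the `k = 0` condensate, in Cooper-coordinate units: for ANY two ground states
  `c₂ (ρ(ψ₃) − ρ(ψ₂)) ≤ κ̃(ψ₃) − κ̃(ψ₂) + η_L`, `κ̃ = −1/log(θ/64)` (junk-free under the premise `θ ≥ 1/L > 0`).
Neither stub is the crux (the first has no `θ/κ̃`, the second no rate in `g`) nor the summit.  Sources: Scalapino1995
§2, RaghuKivelsonScalapino2010 (affine weak-coupling gap equation), MatveevLarkin1997 (parity/pair compressibility of
small grains), Griffiths1966 (condensate vs. local order), KomaTasaki1994.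
-/

set_option linter.dupNamespace false

namespace Summit.HubbardSuperconductivity.HubbardSuperconductivity.Cruxes.LocalConvexStep.Birth

open Summit.HubbardSuperconductivity.HubbardSuperconductivity.Theses.CooperSharpness

/-! ### Stub statements, named (harness skeleton convention A12: the composition cites the stubs BY NAME) -/

/-- statement of `stub_pairCompressibility` -/
def Sig.stub_pairCompressibility : Prop :=
  ∃ U₀ : ℝ, 0 < U₀ ∧ ∃ γ : ℝ, 0 < γ ∧ ∀ U ∈ Set.Ioo (0:ℝ) U₀, ∀ δ ∈ Set.Ioo (0:ℝ) (1 / 2), ∃ s : ℝ, 0 < s ∧ ∃ c₁ : ℝ, 0 < c₁ ∧ ∃ η : ℕ → ℝ, Filter.Tendsto η Filter.atTop (nhds 0) ∧ ∃ L₀ : ℕ, ∀ (L : ℕ) [NeZero L], L₀ ≤ L → Even L → ∀ g₂ g₃ : ℝ, -γ ≤ g₂ → g₂ ≤ g₃ → g₃ ≤ 0 → g₃ ≤ g₂ + s → (∀ g : ℝ, g₂ ≤ g → g ≤ g₃ → ∀ ψ : Literature.MathematicalPhysics.QuantumLattice.Fock (Literature.MathematicalPhysics.QuantumLattice.Orb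 (Literature.MathematicalPhysics.QuantumLattice.FermionTorus 2 L)), star ψ ⬝ᵥ ψ = 1 → Literature.MathematicalPhysics.QuantumLattice.IsGroundStateInSector (Literature.MathematicalPhysics.QuantumLattice.hubbardTorus 2 L 1 U - ((g : ℝ) : ℂ) • (∑ x : Literature.Probability.LatticeModels.TorusSite 2 L, Matrix.conjTranspose (Literature.MathematicalPhysics.QuantumLattice.localPair Literature.MathematicalPhysics.QuantumLattice.dWaveFormFactor L x) * Literature.MathematicalPhysics.QuantumLattice.localPair Literature.MathematicalPhysics.QuantumLattice.dWaveFormFactor L x)) (2 * ⌊(1 - δ) * (L : ℝ) ^ 2 / 2⌋₊) 0 ψ → 1 / (L : ℝ) ≤ ((Literature.MathematicalPhysics.QuantumLattice.expect (Matrix.conjTranspose (Literature.MathematicalPhysics.QuantumLattice.pairField Literature.MathematicalPhysics.QuantumLattice.dWaveFormFactor L) * Literature.MathematicalPhysics.QuantumLattice.pairField Literature.MathematicalPhysics.QuantumLattice.dWaveFormFactor L) ψ).re / (L : ℝ) ^ 4)) → ∀ ψ₃ : Literature.MathematicalPhysics.QuantumLattice.Fock (Literature.MathematicalPhysics.QuantumLattice.Orb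 (Literature.MathematicalPhysics.QuantumLattice.FermionTorus 2 L)), star ψ₃ ⬝ᵥ ψ₃ = 1 → Literature.MathematicalPhysics.QuantumLattice.IsGroundStateInSector (Literature.MathematicalPhysics.QuantumLattice.hubbardTorus 2 L 1 U - ((g₃ : ℝ) : ℂ) • (∑ x : Literature.Probability.LatticeModels.TorusSite 2 L, Matrix.conjTranspose (Literature.MathematicalPhysics.QuantumLattice.localPair Literature.MathematicalPhysics.QuantumLattice.dWaveFormFactor L x) * Literature.MathematicalPhysics.QuantumLattice.localPair Literature.MathematicalPhysics.QuantumLattice.dWaveFormFactor L x)) (2 * ⌊(1 - δ) * (L : ℝ) ^ 2 / 2⌋₊) 0 ψ₃ → ∃ ψ₂ : Literature.MathematicalPhysics.QuantumLattice.Fock (Literature.MathematicalPhysics.QuantumLattice.Orb (Literature.MathematicalPhysics.QuantumLattice.FermionTorus 2 L)), star ψ₂ ⬝ᵥ ψ₂ = 1 ∧ Literature.MathematicalPhysics.QuantumLattice.IsGroundStateInSector (Literature.MathematicalPhysics.QuantumLattice.hubbardTorus 2 L 1 U - ((g₂ : ℝ) : ℂ) • (∑ x : Literature.Probability.LatticeModels.TorusSite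 2 L, Matrix.conjTranspose (Literature.MathematicalPhysics.QuantumLattice.localPair Literature.MathematicalPhysics.QuantumLattice.dWaveFormFactor L x) * Literature.MathematicalPhysics.QuantumLattice.localPair Literature.MathematicalPhysics.QuantumLattice.dWaveFormFactor L x)) (2 * ⌊(1 - δ) * (L : ℝ) ^ 2 / 2⌋₊) 0 ψ₂ ∧ ((Literature.MathematicalPhysics.QuantumLattice.expect (∑ x : Literature.Probability.LatticeModels.TorusSite 2 L, Matrix.conjTranspose (Literature.MathematicalPhysics.QuantumLattice.localPair Literature.MathematicalPhysics.QuantumLattice.dWaveFormFactor L x) * Literature.MathematicalPhysics.QuantumLattice.localPair Literature.MathematicalPhysics.QuantumLattice.dWaveFormFactor L x) ψ₂).re / (L : ℝ) ^ 2) + c₁ * (g₃ - g₂) ≤ ((Literature.MathematicalPhysics.QuantumLattice.expect (∑ x : Literature.Probability.LatticeModels.TorusSite 2 L, Matrix.conjTranspose (Literature.MathematicalPhysics.QuantumLattice.localPair Literature.MathematicalPhysics.QuantumLattice.dWaveFormFactor L x) * Literature.MathematicalPhysics.QuantumLattice.localPair Literature.MathematicalPhysics.QuantumLattice.dWaveFormFactor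 L x) ψ₃).re / (L : ℝ) ^ 2) + η L

/-- statement of `stub_condensateDominance` -/
def Sig.stub_condensateDominance : Prop :=
  ∃ U₀ : ℝ, 0 < U₀ ∧ ∃ γ : ℝ, 0 < γ ∧ ∀ U ∈ Set.Ioo (0:ℝ) U₀, ∀ δ ∈ Set.Ioo (0:ℝ) (1 / 2), ∃ c₂ : ℝ, 0 < c₂ ∧ ∃ η : ℕ → ℝ, Filter.Tendsto η Filter.atTop (nhds 0) ∧ ∃ L₀ : ℕ, ∀ (L : ℕ) [NeZero L], L₀ ≤ L → Even L → ∀ g₂ g₃ : ℝ, -γ ≤ g₂ → g₂ ≤ g₃ → g₃ ≤ 0 → (∀ g : ℝ, g₂ ≤ g → g ≤ g₃ → ∀ ψ : Literature.MathematicalPhysics.QuantumLattice.Fock (Literature.MathematicalPhysics.QuantumLattice.Orb (Literature.MathematicalPhysics.QuantumLattice.FermionTorus 2 L)), star ψ ⬝ᵥ ψ = 1 → Literature.MathematicalPhysics.QuantumLattice.IsGroundStateInSector (Literature.MathematicalPhysics.QuantumLattice.hubbardTorus 2 L 1 U - ((g : ℝ) : ℂ) • (∑ x : Literature.Probability.LatticeModels.TorusSite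 2 L, Matrix.conjTranspose (Literature.MathematicalPhysics.QuantumLattice.localPair Literature.MathematicalPhysics.QuantumLattice.dWaveFormFactor L x) * Literature.MathematicalPhysics.QuantumLattice.localPair Literature.MathematicalPhysics.QuantumLattice.dWaveFormFactor L x)) (2 * ⌊(1 - δ) * (L : ℝ) ^ 2 / 2⌋₊) 0 ψ → 1 / (L : ℝ) ≤ ((Literature.MathematicalPhysics.QuantumLattice.expect (Matrix.conjTranspose (Literature.MathematicalPhysics.QuantumLattice.pairField Literature.MathematicalPhysics.QuantumLattice.dWaveFormFactor L) * Literature.MathematicalPhysics.QuantumLattice.pairField Literature.MathematicalPhysics.QuantumLattice.dWaveFormFactor L) ψ).re / (L : ℝ) ^ 4)) → ∀ ψ₃ : Literature.MathematicalPhysics.QuantumLattice.Fock (Literature.MathematicalPhysics.QuantumLattice.Orb (Literature.MathematicalPhysics.QuantumLattice.FermionTorus 2 L)), star ψ₃ ⬝ᵥ ψ₃ = 1 → Literature.MathematicalPhysics.QuantumLattice.IsGroundStateInSector (Literature.MathematicalPhysics.QuantumLattice.hubbardTorus 2 L 1 U - ((g₃ : ℝ) : ℂ) • (∑ x : Literature.Probability.LatticeModels.TorusSite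 2 L, Matrix.conjTranspose (Literature.MathematicalPhysics.QuantumLattice.localPair Literature.MathematicalPhysics.QuantumLattice.dWaveFormFactor L x) * Literature.MathematicalPhysics.QuantumLattice.localPair Literature.MathematicalPhysics.QuantumLattice.dWaveFormFactor L x)) (2 * ⌊(1 - δ) * (L : ℝ) ^ 2 / 2⌋₊) 0 ψ₃ → ∀ ψ₂ : Literature.MathematicalPhysics.QuantumLattice.Fock (Literature.MathematicalPhysics.QuantumLattice.Orb (Literature.MathematicalPhysics.QuantumLattice.FermionTorus 2 L)), star ψ₂ ⬝ᵥ ψ₂ = 1 → Literature.MathematicalPhysics.QuantumLattice.IsGroundStateInSector (Literature.MathematicalPhysics.QuantumLattice.hubbardTorus 2 L 1 U - ((g₂ : ℝ) : ℂ) • (∑ x : Literature.Probability.LatticeModels.TorusSite 2 L, Matrix.conjTranspose (Literature.MathematicalPhysics.QuantumLattice.localPair Literature.MathematicalPhysics.QuantumLattice.dWaveFormFactor L x) * Literature.MathematicalPhysics.QuantumLattice.localPair Literature.MathematicalPhysics.QuantumLattice.dWaveFormFactor L x)) (2 * ⌊(1 - δ) * (L : ℝ) ^ 2 / 2⌋₊)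 0 ψ₂ → c₂ * (((Literature.MathematicalPhysics.QuantumLattice.expect (∑ x : Literature.Probability.LatticeModels.TorusSite 2 L, Matrix.conjTranspose (Literature.MathematicalPhysics.QuantumLattice.localPair Literature.MathematicalPhysics.QuantumLattice.dWaveFormFactor L x) * Literature.MathematicalPhysics.QuantumLattice.localPair Literature.MathematicalPhysics.QuantumLattice.dWaveFormFactor L x) ψ₃).re / (L : ℝ) ^ 2) - ((Literature.MathematicalPhysics.QuantumLattice.expect (∑ x : Literature.Probability.LatticeModels.TorusSite 2 L, Matrix.conjTranspose (Literature.MathematicalPhysics.QuantumLattice.localPair Literature.MathematicalPhysics.QuantumLattice.dWaveFormFactor L x) * Literature.MathematicalPhysics.QuantumLattice.localPair Literature.MathematicalPhysics.QuantumLattice.dWaveFormFactor L x) ψ₂).re / (L : ℝ) ^ 2)) ≤ (-1 / Real.log (((Literature.MathematicalPhysics.QuantumLattice.expect (Matrix.conjTranspose (Literature.MathematicalPhysics.QuantumLattice.pairField Literature.MathematicalPhysics.QuantumLattice.dWaveFormFactor L) * Literature.MathematicalPhysics.QuantumLattice.pairField Literature.MathematicalPhysics.QuantumLattice.dWaveFormFactor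 L) ψ₃).re / (L : ℝ) ^ 4) / 64)) - (-1 / Real.log (((Literature.MathematicalPhysics.QuantumLattice.expect (Matrix.conjTranspose (Literature.MathematicalPhysics.QuantumLattice.pairField Literature.MathematicalPhysics.QuantumLattice.dWaveFormFactor L) * Literature.MathematicalPhysics.QuantumLattice.pairField Literature.MathematicalPhysics.QuantumLattice.dWaveFormFactor L) ψ₂).re / (L : ℝ) ^ 4) / 64)) + η L

/-- stub: strict pair compressibility over short coupling steps in the incipiently ordered regime. -/
theorem stub_pairCompressibility : Sig.stub_pairCompressibility := by
  sorry

/-- stub (hardest): condensate dominance — the Cooper coordinate gains a fixed multiple of the added pair density. -/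
theorem stub_condensateDominance : Sig.stub_condensateDominance := by
  sorry

/-- Composition (kernel-checked): `b := c₁ c₂`, `η := η₂ + c₂ η₁ → 0`, `L₀ := max`, windows by `min`. [folklore] -/
theorem LocalConvexStep_of (hC : Sig.stub_pairCompressibility) (hD : Sig.stub_condensateDominance) : LocalConvexStep := by
  obtain ⟨U₁, hU₁, γ₁, hγ₁, hC⟩ := hC
  obtain ⟨U₂, hU₂, γ₂, hγ₂, hD⟩ := hD
  refine ⟨min U₁ U₂, lt_min hU₁ hU₂, min γ₁ γ₂, lt_min hγ₁ hγ₂, ?_⟩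
  intro U hU δ hδ
  have hU1 : U ∈ Set.Ioo (0:ℝ) U₁ := ⟨hU.1, lt_of_lt_of_le hU.2 (min_le_left _ _)⟩
  have hU2 : U ∈ Set.Ioo (0:ℝ) U₂ := ⟨hU.1, lt_of_lt_of_le hU.2 (min_le_right _ _)⟩
  have hγ1 : min γ₁ γ₂ ≤ γ₁ := min_le_left _ _
  have hγ2 : min γ₁ γ₂ ≤ γ₂ := min_le_right _ _
  obtain ⟨s, hs, c₁, hc₁, η₁, hη₁, L₁, hcomp⟩ := hC U hU1 δ hδ
  obtain ⟨c₂, hc₂, η₂, hη₂, L₂, hdom⟩ := hD U hU2 δ hδ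
  refine ⟨s, hs, c₁ * c₂, mul_pos hc₁ hc₂, fun L => η₂ L + c₂ * η₁ L, ?_, max L₁ L₂, ?_⟩
  · simpa using hη₂.add (hη₁.const_mul c₂)
  · intro L _ hL hEven g₂ g₃ h2 h23 h3 hs3 hinc ψ₃ hn3 hgs3
    have hL₁ : L₁ ≤ L := le_of_max_le_left hL
    have hL₂ : L₂ ≤ L := le_of_max_le_right hL
    obtain ⟨ψ₂, hn2, hgs2, hρ⟩ := hcomp L hL₁ hEven g₂ g₃ (by linarith) h23 h3 hs3 hinc ψ₃ hn3 hgs3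
    have hκ := hdom L hL₂ hEven g₂ g₃ (by linarith) h23 h3 hinc ψ₃ hn3 hgs3 ψ₂ hn2 hgs2
    refine ⟨ψ₂, hn2, hgs2, ?_⟩
    dsimp only
    have h1 : c₂ * (c₁ * (g₃ - g₂) - η₁ L) ≤ c₂ * (((Literature.MathematicalPhysics.QuantumLattice.expect (∑ x : Literature.Probability.LatticeModels.TorusSite 2 L, Matrix.conjTranspose (Literature.MathematicalPhysics.QuantumLattice.localPair Literature.MathematicalPhysics.QuantumLattice.dWaveFormFactor L x) * Literature.MathematicalPhysics.QuantumLattice.localPair Literature.MathematicalPhysics.QuantumLattice.dWaveFormFactor L x) ψ₃).re / (L : ℝ) ^ 2) - ((Literature.MathematicalPhysics.QuantumLattice.expect (∑ x : Literature.Probability.LatticeModels.TorusSite 2 L, Matrix.conjTranspose (Literature.MathematicalPhysics.QuantumLattice.localPair Literature.MathematicalPhysics.QuantumLattice.dWaveFormFactor L x) * Literature.MathematicalPhysics.QuantumLattice.localPair Literature.MathematicalPhysics.QuantumLattice.dWaveFormFactor L x) ψ₂).re / (L : ℝ) ^ 2)) :=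
      mul_le_mul_of_nonneg_left (by linarith) hc₂.le
    have h2 : c₁ * c₂ * (g₃ - g₂) = c₂ * (c₁ * (g₃ - g₂) - η₁ L) + c₂ * η₁ L := by ring
    linarith [h1, h2, hκ]

/-- The skeleton in its final shape (A12): the crux BY NAME from the two registered stubs, no hypotheses; it depends on
`sorryAx` only through `stub_*` and becomes the crux proof when both stubs are discharged. [folklore] -/
theorem LocalConvexStep_of_stubs : LocalConvexStep :=
  LocalConvexStep_of stub_pairCompressibility stub_condensateDominance

end Summit.HubbardSuperconductivity.HubbardSuperconductivity.Cruxes.LocalConvexStep.Birth
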